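import Literature.Analysis.FluidPDE.MikadoInputs
import Literature.Analysis.FluidPDE.MikadoHeatResidual
import Literature.Analysis.FluidPDE.NestedCutoffProducts
import HarnessLib

/-!
# Supports of the Coiculescu–Palasek blocks: `|supp χ_{k+1}| ≤ 2^{-k}`

Analysis/FluidPDE support file (definitions with proved API; no named facts) on the discharge path of the
principal-parts hypothesis `hA` of
`Literature.Barriers.NavierStokesRegularity.CriticalDataSmoothNonuniqueness_of_principalParts`
(M. P. Coiculescu, S. Palasek, Invent. Math. 244 (2025), arXiv:2503.14699), Lemma 3.3 (supportvolumeestimate: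
"`|Ω̃_k| ≤ 2^{-k}|𝕋³|`") for the concrete cut-offs `χ_k = nestedCutoff P δ₁ (M_m)` of the inputs `mkIter b a`
(`P = pipeSet`, `δ₁ = pipeRadius`). The support of `χ_{k+1}` lies in the closed set

  `Ω_{k+1} = {x : M_m • x ∈ cthickening (2δ₁) P for all m ≤ k}`     (`CP25.fatSupport`),

on which the nested product `∏_{m ≤ k} Φ(M_m •)` of ONE Lipschitz profile `Φ` (`CP25.fatProfile`: `= 1` on
`cthickening (2δ₁) P`, `= 0` off `thickening (8δ₁) P`, `∫Φ ≤ 6·(58δ₁)² ≤ ¼`) is identically `1`; the abstract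
Lemma 3.3 (`measureReal_le_pow_of_prod_comp_nsmul_eq_one`, `NestedCutoffProducts`) then gives

  **`measureReal_fatSupport_succ_le`**: `|Ω_{k+1}| ≤ 2^{-k}` for `a ≥ 2` with `√3·fatLip ≤ a²`,

and the level-`k+1` amplitudes, potentials, their curls and squares all vanish off `Ω_{k+1}`
(`amp_succ_eq_zero`, `apsi_succ_eq_zero`, `curl_apsi_succ_eq_zero`, `curl_curl_apsi_succ_eq_zero`, `ampSqTensor_eq_zero`).

## Mathlib / tree search

Tree: `Torus.mem_thickening_of_nestedCutoff_ne_zero` (`TorusNestedCutoffs`), `Torus.exists_plateau_cutoff`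
(`TorusPlateauCutoff`), `measureReal_le_pow_of_prod_comp_nsmul_eq_one`, `sum_range_natCast_le_two_mul_of_lacunary`
(`NestedCutoffProducts`), `measurePreserving_pipeMap`, `pipeProfile_apply` (`MikadoPipeProfiles`),
`dist_lt_of_pipeBump_ne_zero` (`MikadoPipeGeometry`). Mathlib: `Measure.pi_closedBall`, `AddCircle.volume_closedBall`,
`Metric.thickening_thickening_subset`, `cthickening_subset_thickening'`, `Convex.norm_image_sub_le_of_norm_fderiv_le`.

## References

* M. P. Coiculescu, S. Palasek, Invent. Math. 244 (2025) 165–219, arXiv:2503.14699: Def. 3.1, Lemma 3.3, Def. 3.4,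
  Def. 3.5. [CoiculescuPalasek2025]
-/

noncomputable section

open MeasureTheory Set Filter Function Metric
open _root_.Topology
open scoped BigOperators ContDiff ENNReal NNReal

namespace Literature.Analysis.FluidPDE

namespace CP25

open Literature.Analysis.FunctionSpaces Literature.Analysis.FunctionSpaces.Torus

/-! ## The pipe maps are `3`-Lipschitz; supports of the profiles in pipe coordinates -/

/-- The `j`-th pipe map `y ↦ π₁₂(Φ_j • (y - x_j)) ∈ 𝕋²`. [cite: CoiculescuPalasek2025, §3.1] -/
def pipeMap (j : Fin 6) (y : UnitAddTorus (Fin 3)) : UnitAddTorus (Fin 2) :=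
  planarProj (mulVecT (pipeMatrix (nashDir j 0) (nashDir j 1)) (y - pipeCenter j))

/-- `φ̃_j = ρ ∘ pipeMap_j`. [folklore] -/
theorem pipeFn_eq_pipeBump_pipeMap (j : Fin 6) (y : UnitAddTorus (Fin 3)) : pipeFn j y = pipeBump (pipeMap j y) := by
  rw [pipeFn, pipeProfile_apply]; rfl

/-- The entries of the Nash directions are at most `2` in absolute value. [cite: CoiculescuPalasek2025, §3.1] -/
theorem abs_nashDir_le (j : Fin 6) (i : Fin 3) : |(nashDir j i : ℝ)| ≤ 2 := by
  fin_cases j <;> fin_cases i <;> simp [nashDir]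

/-- `‖Φ_j • w‖ ≤ 3‖w‖` on `𝕋³` (rows `(1,0,-θ₁)`, `(0,1,-θ₂)`, `(0,0,1)` with `|θᵢ| ≤ 2`). [folklore] -/
theorem norm_mulVecT_pipeMatrix_le (j : Fin 6) (w : UnitAddTorus (Fin 3)) :
    ‖mulVecT (pipeMatrix (nashDir j 0) (nashDir j 1)) w‖ ≤ 3 * ‖w‖ := by
  refine (pi_norm_le_iff_of_nonneg (by positivity)).2 fun l => ?_
  rw [mulVecT_apply]
  have hw : ∀ i, ‖w i‖ ≤ ‖w‖ := fun i => norm_le_pi_norm w i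
  have h0 := norm_nonneg w
  have hz : ∀ (n : ℤ) (i : Fin 3), ‖n • w i‖ ≤ |(n : ℝ)| * ‖w‖ := fun n i =>
    calc ‖n • w i‖ ≤ ‖n‖ * ‖w i‖ := norm_zsmul_le _ _
      _ = |(n : ℝ)| * ‖w i‖ := by rw [Int.norm_eq_abs]
      _ ≤ |(n : ℝ)| * ‖w‖ := mul_le_mul_of_nonneg_left (hw i) (abs_nonneg _)
  have h1 := abs_nashDir_le j 0; have h2 := abs_nashDir_le j 1
  fin_cases l
  · simp only [pipeMatrix, Fin.sum_univ_three, Matrix.of_apply, Matrix.cons_val', Matrix.cons_val_zero, Matrix.cons_val_one,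
      Matrix.cons_val_fin_one, Fin.zero_eta, Fin.isValue, one_smul, zero_smul, add_zero]
    calc ‖w 0 + -nashDir j 0 • w 2‖ ≤ ‖w 0‖ + ‖-nashDir j 0 • w 2‖ := norm_add_le _ _
      _ ≤ ‖w‖ + |((-nashDir j 0 : ℤ) : ℝ)| * ‖w‖ := add_le_add (hw 0) (hz _ 2)
      _ ≤ ‖w‖ + 2 * ‖w‖ := by push_cast; rw [abs_neg]; nlinarith
      _ = 3 * ‖w‖ := by ring
  · simp only [pipeMatrix, Fin.sum_univ_three, Matrix.of_apply, Matrix.cons_val', Matrix.cons_val_zero, Matrix.cons_val_one,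
      Matrix.cons_val_fin_one, Fin.mk_one, Fin.isValue, one_smul, zero_smul, zero_add]
    calc ‖w 1 + -nashDir j 1 • w 2‖ ≤ ‖w 1‖ + ‖-nashDir j 1 • w 2‖ := norm_add_le _ _
      _ ≤ ‖w‖ + |((-nashDir j 1 : ℤ) : ℝ)| * ‖w‖ := add_le_add (hw 1) (hz _ 2)
      _ ≤ ‖w‖ + 2 * ‖w‖ := by push_cast; rw [abs_neg]; nlinarith
      _ = 3 * ‖w‖ := by ring
  · simp only [pipeMatrix, Fin.sum_univ_three, Matrix.of_apply, Matrix.cons_val', Matrix.cons_val_zero, Matrix.cons_val_one,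
      Matrix.cons_val_fin_one, Fin.reduceFinMk, Fin.isValue, one_smul, zero_smul, zero_add, Matrix.cons_val]
    linarith [hw 2]

/-- `‖π₁₂ w‖ ≤ ‖w‖`. [folklore] -/
theorem norm_planarProj_le_norm (w : UnitAddTorus (Fin 3)) : ‖planarProj w‖ ≤ ‖w‖ :=
  (pi_norm_le_iff_of_nonneg (norm_nonneg w)).2 fun i => by rw [planarProj_apply]; exact norm_le_pi_norm w _

/-- **The pipe maps are `3`-Lipschitz.** [folklore] -/
theorem dist_pipeMap_le (j : Fin 6) (y y' : UnitAddTorus (Fin 3)) : dist (pipeMap j y) (pipeMap j y') ≤ 3 * dist y y' := by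
  rw [dist_eq_norm, dist_eq_norm, pipeMap, pipeMap]
  have hlin : planarProj (mulVecT (pipeMatrix (nashDir j 0) (nashDir j 1)) (y - pipeCenter j)) -
      planarProj (mulVecT (pipeMatrix (nashDir j 0) (nashDir j 1)) (y' - pipeCenter j)) =
      planarProj (mulVecT (pipeMatrix (nashDir j 0) (nashDir j 1)) (y - y')) := by
    have : y - pipeCenter j - (y' - pipeCenter j) = y - y' := by abel
    have hT : mulVecT (pipeMatrix (nashDir j 0) (nashDir j 1)) (y - pipeCenter j) - mulVecT (pipeMatrix (nashDir j 0) (nashDir j 1)) (y' - pipeCenter j) =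
        mulVecT (pipeMatrix (nashDir j 0) (nashDir j 1)) (y - y') := by rw [← map_sub, this]
    rw [← hT]; rfl
  rw [hlin]
  exact (norm_planarProj_le_norm _).trans (norm_mulVecT_pipeMatrix_le j _)

/-- **Supports in pipe coordinates**: `φ̃_j(y) ≠ 0` forces `dist (pipeMap_j y) 0 < 5δ₁`. [cite: CoiculescuPalasek2025, §3.1] -/
theorem dist_pipeMap_lt_of_pipeFn_ne_zero {j : Fin 6} {y : UnitAddTorus (Fin 3)} (hy : pipeFn j y ≠ 0) :
    dist (pipeMap j y) 0 < 5 * pipeRadius := by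
  rw [pipeFn_eq_pipeBump_pipeMap] at hy
  exact dist_lt_of_pipeBump_ne_zero hy

/-! ## The fat pipe set has tiny measure -/

/-- **The `8δ₁`-fattening of the pipe set lies in the six pipe-coordinate balls of radius `29δ₁`.** [folklore] -/
theorem thickening_pipeSet_subset :
    thickening (8 * pipeRadius) pipeSet ⊆ ⋃ j, pipeMap j ⁻¹' closedBall 0 (29 * pipeRadius) := by
  intro y hy
  obtain ⟨z, hz, hyz⟩ := mem_thickening_iff.1 hy
  obtain ⟨j, hj⟩ := mem_iUnion.1 hz
  refine mem_iUnion.2 ⟨j, ?_⟩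
  rw [mem_preimage, mem_closedBall]
  have h1 := dist_pipeMap_le j y z
  have h2 := dist_pipeMap_lt_of_pipeFn_ne_zero (j := j) hj
  calc dist (pipeMap j y) 0 ≤ dist (pipeMap j y) (pipeMap j z) + dist (pipeMap j z) 0 := dist_triangle _ _ _
    _ ≤ 3 * dist y z + 5 * pipeRadius := by linarith
    _ ≤ 29 * pipeRadius := by linarith [hyz.le]

/-- The volume of a small closed ball of `𝕋²` (sup metric): `|B̄(0,r)| ≤ (2r)²`. [folklore] -/
theorem volume_closedBall_torus_two_le {r : ℝ} (hr : 0 ≤ r) :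
    volume (closedBall (0 : UnitAddTorus (Fin 2)) r) ≤ ENNReal.ofReal (2 * r) ^ 2 := by
  have hpi : (volume : Measure (UnitAddTorus (Fin 2))) (closedBall (0 : UnitAddTorus (Fin 2)) r) =
      ∏ i : Fin 2, (volume : Measure UnitAddCircle) (closedBall ((0 : UnitAddTorus (Fin 2)) i) r) :=
    Measure.pi_closedBall (fun _ : Fin 2 => (volume : Measure UnitAddCircle)) (0 : UnitAddTorus (Fin 2)) hr
  rw [hpi]
  simp only [Finset.prod_const, Finset.card_univ, Fintype.card_fin, Pi.zero_apply]
  gcongr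
  rw [AddCircle.volume_closedBall]
  exact ENNReal.ofReal_le_ofReal (min_le_right _ _)

/-- The pipe-coordinate balls pull back to sets of the same measure. [folklore] -/
theorem volume_preimage_pipeMap_closedBall (j : Fin 6) (r : ℝ) :
    volume (pipeMap j ⁻¹' closedBall (0 : UnitAddTorus (Fin 2)) r) = volume (closedBall (0 : UnitAddTorus (Fin 2)) r) :=
  (measurePreserving_pipeMap (nashDir j 0) (nashDir j 1) (pipeCenter j)).measure_preimage measurableSet_closedBall.nullMeasurableSet

/-- **The fat pipe set is tiny**: `|thickening (8δ₁) P| ≤ 6 (58δ₁)² ≤ ¼`. [cite: CoiculescuPalasek2025, Lemma 3.3 (proof: "`|supp φ_k| ≤ 4δ`")] -/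
theorem measureReal_thickening_pipeSet_le : volume.real (thickening (8 * pipeRadius) pipeSet) ≤ 1 / 4 := by
  have hδ := pipeRadius_pos
  have hball : ∀ j, volume.real (pipeMap j ⁻¹' closedBall (0 : UnitAddTorus (Fin 2)) (29 * pipeRadius)) ≤ (58 * pipeRadius) ^ 2 := by
    intro j
    rw [measureReal_def, volume_preimage_pipeMap_closedBall]
    have h := volume_closedBall_torus_two_le (r := 29 * pipeRadius) (by positivity)
    have hfin : ENNReal.ofReal (2 * (29 * pipeRadius)) ^ 2 ≠ ⊤ := ENNReal.pow_ne_top ENNReal.ofReal_ne_top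
    calc (volume (closedBall (0 : UnitAddTorus (Fin 2)) (29 * pipeRadius))).toReal ≤ (ENNReal.ofReal (2 * (29 * pipeRadius)) ^ 2).toReal :=
          ENNReal.toReal_mono hfin h
      _ = (58 * pipeRadius) ^ 2 := by
          rw [ENNReal.toReal_pow, ENNReal.toReal_ofReal (by positivity)]; ring
  calc volume.real (thickening (8 * pipeRadius) pipeSet) ≤ volume.real (⋃ j, pipeMap j ⁻¹' closedBall (0 : UnitAddTorus (Fin 2)) (29 * pipeRadius)) :=
        measureReal_mono thickening_pipeSet_subset
    _ ≤ ∑ j, volume.real (pipeMap j ⁻¹' closedBall (0 : UnitAddTorus (Fin 2)) (29 * pipeRadius)) := measureReal_iUnion_fintype_le _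
    _ ≤ ∑ _j : Fin 6, (58 * pipeRadius) ^ 2 := Finset.sum_le_sum fun j _ => hball j
    _ = 6 * (58 * pipeRadius) ^ 2 := by simp
    _ ≤ 1 / 4 := by unfold pipeRadius; norm_num

/-! ## The dominating profile `Φ` -/

/-- **The dominating profile `Φ`**: a smooth `[0,1]`-valued cut-off equal to `1` on `thickening δ₁ (thickening (3δ₁) P)`
and to `0` off `thickening (5δ₁) (thickening (3δ₁) P)` (choice from `Torus.exists_plateau_cutoff`).
[cite: CoiculescuPalasek2025, Lemma 3.3 (proof: the functions `φ_k`)] -/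
def fatProfile : UnitAddTorus (Fin 3) → ℝ :=
  Classical.choose (exists_plateau_cutoff (thickening (3 * pipeRadius) pipeSet) pipeRadius_pos pipeRadius_le)

/-- The defining properties of `fatProfile`. [cite: CoiculescuPalasek2025, Lemma 3.3] -/
theorem fatProfile_spec :
    IsSmooth fatProfile ∧ (∀ x, 0 ≤ fatProfile x ∧ fatProfile x ≤ 1) ∧
      (∀ x ∈ thickening pipeRadius (thickening (3 * pipeRadius) pipeSet), fatProfile x = 1) ∧
      (∀ x ∉ thickening (5 * pipeRadius) (thickening (3 * pipeRadius) pipeSet), fatProfile x = 0) ∧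
      ∀ (n : ℕ) (y : EuclideanSpace ℝ (Fin 3)), ‖iteratedFDeriv ℝ n (lift fatProfile) y‖ ≤ derivProfileMass (Fin 3) n * (pipeRadius ^ n)⁻¹ :=
  Classical.choose_spec (exists_plateau_cutoff (thickening (3 * pipeRadius) pipeSet) pipeRadius_pos pipeRadius_le)

/-- **The Lipschitz constant of `Φ`**: `fatLip = derivProfileMass 1 / δ₁`. [folklore] -/
def fatLip : ℝ := derivProfileMass (Fin 3) 1 * (pipeRadius ^ 1)⁻¹

/-- `0 ≤ fatLip`. [folklore] -/
theorem fatLip_nonneg : 0 ≤ fatLip := by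
  have h := fatProfile_spec.2.2.2.2 1 0
  exact (norm_nonneg _).trans h

/-- `Φ ∈ [0,1]`. [folklore] -/
theorem fatProfile_mem_Icc (x : UnitAddTorus (Fin 3)) : fatProfile x ∈ Icc (0 : ℝ) 1 := fatProfile_spec.2.1 x

/-- **`Φ = 1` on `cthickening (2δ₁) P`.** [folklore] -/
theorem fatProfile_eq_one {x : UnitAddTorus (Fin 3)} (hx : x ∈ cthickening (2 * pipeRadius) pipeSet) : fatProfile x = 1 := by
  have hδ := pipeRadius_pos
  refine fatProfile_spec.2.2.1 x ?_
  have h3 : x ∈ thickening (3 * pipeRadius) pipeSet := cthickening_subset_thickening' (by positivity) (by linarith) _ hx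
  exact self_subset_thickening hδ _ h3

/-- `Φ = 0` off `thickening (8δ₁) P`. [folklore] -/
theorem fatProfile_eq_zero {x : UnitAddTorus (Fin 3)} (hx : x ∉ thickening (8 * pipeRadius) pipeSet) : fatProfile x = 0 := by
  refine fatProfile_spec.2.2.2.1 x fun h => hx ?_
  have := thickening_thickening_subset (5 * pipeRadius) (3 * pipeRadius) pipeSet h
  rwa [show 5 * pipeRadius + 3 * pipeRadius = 8 * pipeRadius by ring] at this

/-- **`Φ` is `fatLip`-Lipschitz along the lift.** [folklore] -/
theorem abs_fatProfile_sub_le (y y' : EuclideanSpace ℝ (Fin 3)) : |fatProfile (proj y) - fatProfile (proj y')| ≤ fatLip * ‖y - y'‖ := by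
  have hs := fatProfile_spec.1
  have h1 : ∀ z, ‖fderiv ℝ (lift fatProfile) z‖ ≤ fatLip := by
    intro z
    have := fatProfile_spec.2.2.2.2 1 z
    rw [← norm_iteratedFDeriv_one (𝕜 := ℝ)]
    exact this
  have hdiff : Differentiable ℝ (lift fatProfile) := hs.differentiable (by simp)
  have hmv := Convex.norm_image_sub_le_of_norm_fderiv_le (fun z _ => hdiff.differentiableAt) (fun z _ => h1 z) convex_univ (mem_univ y') (mem_univ y)
  rw [lift_apply, lift_apply, Real.norm_eq_abs] at hmv
  exact hmv

/-- **`∫Φ ≤ ¼`.** [cite: CoiculescuPalasek2025, Lemma 3.3 (proof: "`|supp φ_k| ≤ 4δ`")] -/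
theorem integral_fatProfile_le : ∫ x, fatProfile x ≤ 1 / 4 := by
  have hmeas : MeasurableSet (thickening (8 * pipeRadius) pipeSet) := isOpen_thickening.measurableSet
  have hle : ∀ x, fatProfile x ≤ (thickening (8 * pipeRadius) pipeSet).indicator (fun _ => (1 : ℝ)) x := by
    intro x
    by_cases hx : x ∈ thickening (8 * pipeRadius) pipeSet
    · rw [indicator_of_mem hx]; exact (fatProfile_mem_Icc x).2
    · rw [indicator_of_notMem hx, fatProfile_eq_zero hx]
  have hint : Integrable ((thickening (8 * pipeRadius) pipeSet).indicator fun _ => (1 : ℝ)) volume := (integrable_const _).indicator hmeas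
  calc ∫ x, fatProfile x ≤ ∫ x, (thickening (8 * pipeRadius) pipeSet).indicator (fun _ => (1 : ℝ)) x :=
        integral_mono_of_nonneg (Eventually.of_forall fun x => (fatProfile_mem_Icc x).1) hint (Eventually.of_forall hle)
    _ = volume.real (thickening (8 * pipeRadius) pipeSet) := by rw [integral_indicator_const _ hmeas, smul_eq_mul, mul_one]
    _ ≤ 1 / 4 := measureReal_thickening_pipeSet_le

/-! ## The fat supports `Ω_k` and their measure -/

/-- `δ₁ ≤ 1`. [folklore] -/
theorem pipeRadius_le_one : pipeRadius ≤ 1 := pipeRadius_le.trans (by norm_num)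

/-- `M_m ≥ 1`… precisely `0 < M_m` for `a ≥ 1`. [folklore] -/
theorem scaleM_pos' {a : ℕ} (ha : 1 ≤ a) (b m : ℕ) : 0 < scaleM a b m := one_le_scaleM ha b m

/-- Lacunarity of the dilations: `2M_m ≤ M_{m+1}` for `a ≥ 2`, `b ≥ 2`. [folklore] -/
theorem two_mul_scaleM_le_succ {a b : ℕ} (ha : 2 ≤ a) (hb : 2 ≤ b) (m : ℕ) : 2 * scaleM a b m ≤ scaleM a b (m + 1) := by
  rw [scaleM_succ]
  have hM : 2 ≤ scaleM a b m := le_trans ha (le_scaleM (by omega) (by omega) m)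
  calc 2 * scaleM a b m ≤ scaleM a b m * scaleM a b m := Nat.mul_le_mul_right _ hM
    _ = scaleM a b m ^ 2 := (sq _).symm
    _ ≤ scaleM a b m ^ b := Nat.pow_le_pow_right (by omega) hb

/-- `a^{m+1} ≤ M_m = a^{b^m}` for `a ≥ 1`, `b ≥ 2` (`m + 1 ≤ b^m`). [folklore] -/
theorem pow_le_scaleM {a b : ℕ} (ha : 1 ≤ a) (hb : 2 ≤ b) (m : ℕ) : a ^ (m + 1) ≤ scaleM a b m := by
  unfold scaleM
  refine Nat.pow_le_pow_right ha ?_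
  have : m < b ^ m := Nat.lt_pow_self (by omega)
  omega

/-- **The fat support at level `k`** for the dilations `M`: `Ω_k = {x : M_m • x ∈ cthickening (2δ₁) P, m < k}` (closed; contains
`supp χ_k`). [cite: CoiculescuPalasek2025, Lemma 3.3 (`Ω̃_k`)] -/
def fatSupport (M : ℕ → ℕ) (k : ℕ) : Set (UnitAddTorus (Fin 3)) :=
  {x | ∀ m, m < k → M m • x ∈ cthickening (2 * pipeRadius) pipeSet}

/-- `Ω_k` is closed. [folklore] -/
theorem isClosed_fatSupport (M : ℕ → ℕ) (k : ℕ) : IsClosed (fatSupport M k) := by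
  have : fatSupport M k = ⋂ m ∈ Finset.range k, (fun x : UnitAddTorus (Fin 3) => M m • x) ⁻¹' cthickening (2 * pipeRadius) pipeSet := by
    ext x; simp [fatSupport]
  rw [this]
  exact isClosed_biInter fun m _ => isClosed_cthickening.preimage (continuous_nsmul (M m))

/-- **`supp χ_k ⊆ Ω_k`** for the nested cut-offs of the pipe set. [cite: CoiculescuPalasek2025, Lemma 3.3 (`supp ψ_k ⊆ Ω̃_k`)] -/
theorem mem_fatSupport_of_nestedCutoff_ne_zero (M : ℕ → ℕ) (k : ℕ) {x : UnitAddTorus (Fin 3)}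
    (hx : nestedCutoff pipeSet pipeRadius M k x ≠ 0) : x ∈ fatSupport M k := fun _ hm =>
  thickening_subset_cthickening _ _ (mem_thickening_of_nestedCutoff_ne_zero pipeRadius_pos pipeRadius_le_one k hx hm)

/-- **`tsupport χ_k ⊆ Ω_k`.** [folklore] -/
theorem tsupport_nestedCutoff_subset (M : ℕ → ℕ) (k : ℕ) : tsupport (nestedCutoff pipeSet pipeRadius M k) ⊆ fatSupport M k :=
  closure_minimal (fun _ hx => mem_fatSupport_of_nestedCutoff_ne_zero M k hx) (isClosed_fatSupport M k)

/-- On `Ω_{k+1}` the nested product of `Φ` is `1`. [folklore] -/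
theorem prod_fatProfile_eq_one (M : ℕ → ℕ) (k : ℕ) {x : UnitAddTorus (Fin 3)} (hx : x ∈ fatSupport M (k + 1)) :
    ∏ m ∈ Finset.range (k + 1), fatProfile (M m • x) = 1 :=
  Finset.prod_eq_one fun m hm => fatProfile_eq_one (hx m (Finset.mem_range.1 hm))

/-- **Lemma 3.3 for the concrete scales**: for `M_m = a^{b^m}` with `2 ≤ a`, `1 ≤ b`... precisely `4 ≤ b` and `√3·fatLip ≤ a²`,
`|Ω_{k+1}| ≤ 2^{-k}`. [cite: CoiculescuPalasek2025, Lemma 3.3 (supportvolumeestimate)] -/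
theorem measureReal_fatSupport_succ_le {a b : ℕ} (hb : 4 ≤ b) (ha : 2 ≤ a) (haL : Real.sqrt 3 * fatLip ≤ (a : ℝ) ^ 2) (k : ℕ) :
    volume.real (fatSupport (scaleM a b) (k + 1)) ≤ (1 / 2 : ℝ) ^ k := by
  have hM : ∀ m, 0 < scaleM a b m := fun m => scaleM_pos' (by omega) b m
  have hlac : ∀ m, 2 * scaleM a b m ≤ scaleM a b (m + 1) := fun m => two_mul_scaleM_le_succ ha (by omega) m
  refine measureReal_le_pow_of_prod_comp_nsmul_eq_one (φ := fatProfile) (L := fatLip) (M := scaleM a b) fatProfile_mem_Icc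
    abs_fatProfile_sub_le fatLip_nonneg hM (by norm_num) (by norm_num) (by linarith [integral_fatProfile_le]) (fun m => ?_)
    (isClosed_fatSupport _ _).measurableSet k (fun x hx => prod_fatProfile_eq_one _ k hx)
  -- growth: `fatLip √3 ∑_{j ≤ m} M_j ≤ 2 fatLip √3 M_m ≤ 2^{-m} M_{m+1}`
  have hcard : (Fintype.card (Fin 3) : ℝ) = 3 := by simp
  rw [hcard]
  have h1 := sum_range_natCast_le_two_mul_of_lacunary hlac m
  have h2 : 0 ≤ fatLip * Real.sqrt 3 := by have := fatLip_nonneg; positivity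
  have ha2 : (2 : ℝ) ≤ a := by exact_mod_cast ha
  have hMm : (a : ℝ) ^ (m + 1) ≤ scaleM a b m := by
    have := pow_le_scaleM (a := a) (b := b) (by omega) (by omega) m
    exact_mod_cast this
  have hsucc : ((scaleM a b (m + 1) : ℕ) : ℝ) = ((scaleM a b m : ℕ) : ℝ) ^ b := by rw [scaleM_succ]; push_cast; ring
  have hM1 : (1 : ℝ) ≤ scaleM a b m := by exact_mod_cast hM m
  -- `2^{m+1} fatLip √3 ≤ M_m^{b-1}`: `M_m^{b-1} ≥ M_m^3 ≥ a^{3(m+1)} ≥ 2^{m+1} a²`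
  calc fatLip * Real.sqrt 3 * ∑ j ∈ Finset.range (m + 1), (scaleM a b j : ℝ) ≤ fatLip * Real.sqrt 3 * (2 * scaleM a b m) :=
        mul_le_mul_of_nonneg_left h1 h2
    _ = (2 * (Real.sqrt 3 * fatLip)) * scaleM a b m := by ring
    _ ≤ (1 / 2 : ℝ) ^ m * scaleM a b (m + 1) := by
        rw [hsucc]
        -- reduce to `2^{m+1} (√3 fatLip) ≤ M^{b-1}`
        have key : (2 : ℝ) ^ (m + 1) * (Real.sqrt 3 * fatLip) ≤ ((scaleM a b m : ℕ) : ℝ) ^ (b - 1) := by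
          have e1 : ((scaleM a b m : ℕ) : ℝ) ^ 3 ≤ ((scaleM a b m : ℕ) : ℝ) ^ (b - 1) := pow_le_pow_right₀ hM1 (by omega)
          have e2 : ((a : ℝ) ^ (m + 1)) ^ 3 ≤ ((scaleM a b m : ℕ) : ℝ) ^ 3 := pow_le_pow_left₀ (by positivity) hMm 3
          have e3 : (2 : ℝ) ^ (m + 1) * (a : ℝ) ^ 2 ≤ ((a : ℝ) ^ (m + 1)) ^ 3 := by
            have : ((a : ℝ) ^ (m + 1)) ^ 3 = (a : ℝ) ^ (m + 1) * ((a : ℝ) ^ (m + 1)) ^ 2 := by ring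
            rw [this]
            refine mul_le_mul (pow_le_pow_left₀ (by norm_num) ha2 _) ?_ (by positivity) (by positivity)
            calc (a : ℝ) ^ 2 = ((a : ℝ) ^ 1) ^ 2 := by ring
              _ ≤ ((a : ℝ) ^ (m + 1)) ^ 2 := pow_le_pow_left₀ (by positivity) (pow_le_pow_right₀ (by linarith) (by omega)) 2
          calc (2 : ℝ) ^ (m + 1) * (Real.sqrt 3 * fatLip) ≤ (2 : ℝ) ^ (m + 1) * (a : ℝ) ^ 2 := mul_le_mul_of_nonneg_left haL (by positivity)
            _ ≤ _ := e3.trans (e2.trans e1)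
        have hpow : ((scaleM a b m : ℕ) : ℝ) ^ b = ((scaleM a b m : ℕ) : ℝ) ^ (b - 1) * scaleM a b m := by
          rw [← pow_succ, Nat.sub_add_cancel (by omega : 1 ≤ b)]
        rw [hpow]
        have h12 : (1 / 2 : ℝ) ^ m * (((scaleM a b m : ℕ) : ℝ) ^ (b - 1) * scaleM a b m) =
            (((2 : ℝ) ^ m)⁻¹ * ((scaleM a b m : ℕ) : ℝ) ^ (b - 1)) * scaleM a b m := by rw [one_div, inv_pow]; ring
        rw [h12]
        have hM0 : (0 : ℝ) < scaleM a b m := by linarith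
        refine mul_le_mul_of_nonneg_right ?_ hM0.le
        rw [le_inv_mul_iff₀ (by positivity)]
        calc (2 : ℝ) ^ m * (2 * (Real.sqrt 3 * fatLip)) = (2 : ℝ) ^ (m + 1) * (Real.sqrt 3 * fatLip) := by ring
          _ ≤ _ := key

/-! ## Supports of the level-`k+1` objects of the iteration -/

/-- A function vanishing near `x` has all partial derivatives `0` at `x` (any normed target). [folklore] -/
theorem partialDeriv_eq_zero_of_eventuallyEq_zero {F : Type*} [NormedAddCommGroup F] [NormedSpace ℝ F] {f : UnitAddTorus (Fin 3) → F}
    {x : UnitAddTorus (Fin 3)} (hf : ∀ᶠ y in 𝓝 x, f y = 0) (j : Fin 3) : Torus.partialDeriv j f x = 0 := by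
  unfold Torus.partialDeriv Torus.lineDeriv
  have hc : Tendsto (fun t : ℝ => x + proj (t • EuclideanSpace.single j (1 : ℝ))) (𝓝 0) (𝓝 x) := by
    have : Continuous fun t : ℝ => x + proj (t • EuclideanSpace.single j (1 : ℝ)) :=
      continuous_const.add (continuous_proj.comp (continuous_id.smul continuous_const))
    have h0 := this.continuousAt (x := 0)
    rwa [ContinuousAt, zero_smul, proj_zero, add_zero] at h0
  have hev : (fun t : ℝ => f (x + proj (t • EuclideanSpace.single j (1 : ℝ)))) =ᶠ[𝓝 0] fun _ => (0 : F) := hc.eventually hf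
  rw [hev.deriv_eq]
  simp

/-- **The curl of a field vanishing on an open set vanishes there.** [folklore] -/
theorem curl_eq_zero_of_eventuallyEq_zero {u : UnitAddTorus (Fin 3) → EuclideanSpace ℝ (Fin 3)} {x : UnitAddTorus (Fin 3)}
    (hu : ∀ᶠ y in 𝓝 x, u y = 0) : BDSV.curl u x = 0 := by
  have hc : ∀ i, Torus.partialDeriv i u x = 0 := fun i => partialDeriv_eq_zero_of_eventuallyEq_zero hu i
  ext l
  fin_cases l <;> simp [BDSV.curl, hc]

namespace IterData

variable (I : IterData)

/-- **`a_{j,k+1} = 0` where `χ_{k+1} = 0`.** [cite: CoiculescuPalasek2025, Def. 3.5 (`a_{j,k+1} = … χ_{k+1} Γ_j(…)`)] -/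
theorem amp_succ_eq_zero {k : ℕ} {j : Fin 6} {x : UnitAddTorus (Fin 3)} (hx : I.χ (k + 1) x = 0) : I.amp (k + 1) j x = 0 := by
  simp [amp, ampCoeff, hx]

/-- `a_{j,k+1}Ψ⁰_{j,k+1} = 0` where `χ_{k+1} = 0`. [folklore] -/
theorem apsi_succ_eq_zero {k : ℕ} {j : Fin 6} {x : UnitAddTorus (Fin 3)} (hx : I.χ (k + 1) x = 0) : I.apsi (k + 1) j x = 0 := by
  simp [apsi, I.amp_succ_eq_zero hx]

/-- `a²_{j,k+1} θ_j⊗θ_j = 0` where `χ_{k+1} = 0`. [folklore] -/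
theorem ampSqTensor_eq_zero {k : ℕ} {j : Fin 6} {x : UnitAddTorus (Fin 3)} (hx : I.χ (k + 1) x = 0) (a b : Fin 3) :
    I.ampSqTensor k j x a b = 0 := by
  simp [ampSqTensor, I.amp_succ_eq_zero hx]

/-- Off the closed set `tsupport χ_{k+1}`, `χ_{k+1}` vanishes near the point. [folklore] -/
theorem eventually_chi_eq_zero {k : ℕ} {x : UnitAddTorus (Fin 3)} (hx : x ∉ tsupport (I.χ (k + 1))) : ∀ᶠ y in 𝓝 x, I.χ (k + 1) y = 0 := by
  have hopen : IsOpen (tsupport (I.χ (k + 1)))ᶜ := (isClosed_tsupport _).isOpen_compl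
  exact Filter.mem_of_superset (hopen.mem_nhds hx) fun y hy => image_eq_zero_of_notMem_tsupport hy

/-- **`curl(a_{j,k+1}Ψ⁰) = 0` off `tsupport χ_{k+1}`.** [folklore] -/
theorem curl_apsi_succ_eq_zero {k : ℕ} {j : Fin 6} {x : UnitAddTorus (Fin 3)} (hx : x ∉ tsupport (I.χ (k + 1))) :
    BDSV.curl (I.apsi (k + 1) j) x = 0 :=
  curl_eq_zero_of_eventuallyEq_zero ((I.eventually_chi_eq_zero hx).mono fun _ hy => I.apsi_succ_eq_zero hy)

/-- **`curl curl(a_{j,k+1}Ψ⁰) = 0` off `tsupport χ_{k+1}`.** [folklore] -/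
theorem curl_curl_apsi_succ_eq_zero {k : ℕ} {j : Fin 6} {x : UnitAddTorus (Fin 3)} (hx : x ∉ tsupport (I.χ (k + 1))) :
    BDSV.curl (BDSV.curl (I.apsi (k + 1) j)) x = 0 := by
  refine curl_eq_zero_of_eventuallyEq_zero ?_
  have hopen : IsOpen (tsupport (I.χ (k + 1)))ᶜ := (isClosed_tsupport _).isOpen_compl
  exact Filter.mem_of_superset (hopen.mem_nhds hx) fun y hy => I.curl_apsi_succ_eq_zero hy

end IterData

/-- **For the concrete inputs, `tsupport χ_{k+1} ⊆ Ω_{k+1}`.** [cite: CoiculescuPalasek2025, Lemma 3.3] -/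
theorem tsupport_chi_mkIter_subset (b a k : ℕ) : tsupport ((mkIter b a).χ (k + 1)) ⊆ fatSupport (scaleM a b) (k + 1) :=
  tsupport_nestedCutoff_subset (scaleM a b) (k + 1)

end CP25

end Literature.Analysis.FluidPDE
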